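import Mathlib
import Summits.ResolutionOfSingularities.ResolutionOfSingularities.Theorems.HomologicalConductorNoZenoStableAnnihilatorReduction
import Summits.ResolutionOfSingularities.ResolutionOfSingularities.Theorems.HomologicalConductorPersistenceHullTransfer
import HarnessLib

/-!
# Crux `PersistenceSurface` (stmt-ResolutionOfSingularities-19970) · S-2 algebraic assembly — the HULL-COVER
# persistence lemmas HC-R / HC-3 / HC-1 / HC-2 / HC-0 (res-L1-w44b-plan-1's CRUX-PLAN v6 §3.1, ORDER w44b-o1;
# typed targets `L/w44b/Sketch-S2-HullCover.lean` aa6f788edfc7fa17, re-typed against the tree)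

Route `ResolutionOfSingularities/HomologicalConductor`, chain W4.4b (cell res-hironaka; seat res-type-028 on
res-L1-w44b-plan-1's ORDER w44b-o1). OURS; nothing here is a statement of the manuscript under review (Hironaka 2017);
AI-written, weaker than expert review. Recurrence-agnostic, dimension-free commutative algebra over the W4.4 CA-layer
(`StablyAnnihilates`, `StablyAnnihilates.dual`, CA1 `mem_cohomologyAnnihilatorOfDegree_succ_iff_forall_isSyzygy` —
`…Theorems.HomologicalConductorNoZenoStableAnnihilatorReduction`, imported BY NAME, nothing written into
`NoZeno.SandwichCluster`) and the w44b transfer lemmas (`…Theorems.HomologicalConductorPersistenceHullTransfer`: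
`exists_comp_eq_smul_id_baseChange`): the geometry of a rational stage ((E-sur), (Rec), KRS of CRUX-PLAN v6 §2) is
packed into the COVER HYPOTHESIS `hcover` and stays memo-level.

* `stablyAnnihilates_of_linearMap` / `stablyAnnihilates_iff_exists_linearMap` — BRIDGE between the CA-layer's
  `StablyAnnihilates T x M` (the homothety `x • 𝟙 M` factors through a finitely generated projective of `ModuleCat T`)
  and the transfer lemmas' free form (a factorisation `π ∘ ι = x • id` through `Fin s → T` by `T`-linear maps): a
  finitely generated projective is a retract of a finite free module.
* **HC-R** `StablyAnnihilates.of_retract` — retracts inherit stable annihilation (`i ≫ r = 𝟙 N`).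
* **HC-3** `StablyAnnihilates.baseChange` — base change `T → T'`: `x ∈ s̲ann_T(Y) ⇒ algebraMap x ∈ s̲ann_{T'}(T' ⊗_T Y)`
  (free form + `exists_comp_eq_smul_id_baseChange`); corollaries `.dual_baseChange`, `.dual_dual_baseChange`.
* **HC-1** `map_mem_cohomologyAnnihilatorOfDegree_succ_of_dualBaseChangeCover` — if every `m`-th syzygy `L` over `T'` is
  a retract of `Hom_{T'}(T' ⊗_T Y, T')` for some finitely generated `T`-module `Y` with `x ∈ s̲ann_T(Y)`, then
  `algebraMap T T' x ∈ caᵐ⁺¹(T')` (CA1 backward over `T'`; exponent one; no flatness / reflexivity hypotheses).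
* **HC-2** `map_mem_cohomologyAnnihilatorOfDegree_succ_of_hullBaseChangeCover` — the same with the reflexive hull
  `(T' ⊗_T Y)**`; and `…_of_baseChangeCover` — the same with `T' ⊗_T Y` itself.
* **HC-0** `stablyAnnihilates_of_mem_cohomologyAnnihilatorOfDegree_succ` — the source side (CA1 forward).

References: S. B. Iyengar, R. Takahashi, *Annihilation of cohomology and strong generation of module categories*,
IMRN 2016, arXiv:1404.1476, §2 (Remark 2.13) [`IyengarTakahashi2014`].
-/

-- single-problem summit: the doubled namespace component `ResolutionOfSingularities` is forced
set_option linter.dupNamespace false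

noncomputable section

open CategoryTheory Literature.RingTheory.CohomologyAnnihilator
open Summit.ResolutionOfSingularities.ResolutionOfSingularities.Theorems.NoZeno.SandwichCluster
open Summit.ResolutionOfSingularities.ResolutionOfSingularities.Theorems.HomologicalConductor.PersistenceHullTransfer
open scoped TensorProduct

universe u

namespace Summit.ResolutionOfSingularities.ResolutionOfSingularities.Theorems.HomologicalConductor.PersistenceSurfaceHullCover

/-! ## The bridge: finitely generated projective factorisations vs. finite free ones -/

/-- A factorisation of the homothety `x • id_M` through a finite free module `Fin s → T` by `T`-linear maps makes `x`
stably annihilate `ModuleCat.of T M` (a finite free module is finitely generated projective). [folklore] -/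
theorem stablyAnnihilates_of_linearMap {T : Type u} [CommRing T] {M : Type u} [AddCommGroup M] [Module T M] {x : T}
    {s : ℕ} (ι : M →ₗ[T] (Fin s → T)) (π : (Fin s → T) →ₗ[T] M) (h : π ∘ₗ ι = x • LinearMap.id) :
    StablyAnnihilates T x (ModuleCat.of T M) := by
  refine ⟨ModuleCat.of T (Fin s → T), inferInstance,
    (IsProjective.iff_projective (R := T) (Fin s → T)).mp inferInstance,
    ModuleCat.ofHom ι, ModuleCat.ofHom π, ?_⟩
  ext m
  have hm : π (ι m) = x • m := LinearMap.congr_fun h m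
  simp [hm]

/-- **Bridge.** `x` stably annihilates `M` iff `x • id_M` factors through a finite FREE module `Fin s → T`: a finitely
generated projective `P` is a retract of some `Fin s → T` (`Module.Finite.exists_fin'` gives `q : (Fin s → T) ↠ P`,
`Module.projective_lifting_property` a section of `q`). [folklore] -/
theorem stablyAnnihilates_iff_exists_linearMap {T : Type u} [CommRing T] (x : T) (M : ModuleCat.{u} T) :
    StablyAnnihilates T x M ↔
      ∃ (s : ℕ) (ι : M →ₗ[T] (Fin s → T)) (π : (Fin s → T) →ₗ[T] M), π ∘ₗ ι = x • LinearMap.id := by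
  constructor
  · rintro ⟨P, hPfin, hP, ι, π, hιπ⟩
    haveI := hPfin
    haveI := hP
    haveI : Module.Projective T P := P.projective_of_module_projective
    obtain ⟨s, q, hq⟩ := Module.Finite.exists_fin' T P
    obtain ⟨σ, hσ⟩ := Module.projective_lifting_property q (LinearMap.id : P →ₗ[T] P) hq
    refine ⟨s, σ ∘ₗ ι.hom, π.hom ∘ₗ q, LinearMap.ext fun m => ?_⟩
    have h1 : q (σ (ι.hom m)) = ι.hom m := LinearMap.congr_fun hσ (ι.hom m)
    simp only [LinearMap.comp_apply, h1, apply_apply_eq_smul_of_comp_eq_smul_id hιπ m,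
      LinearMap.smul_apply, LinearMap.id_apply]
  · rintro ⟨s, ι, π, h⟩
    exact stablyAnnihilates_of_linearMap ι π h

/-! ## HC-R: retracts -/

/-- **HC-R · retracts inherit stable annihilation** (mirror of `StablyAnnihilates.of_iso`): if `ι ≫ π = x • 𝟙 M`
through a finitely generated projective `P` and `N` is a retract of `M` (`i ≫ r = 𝟙 N`), then
`(i ≫ ι) ≫ (π ≫ r) = x • 𝟙 N`. [folklore] -/
theorem StablyAnnihilates.of_retract {T : Type u} [CommRing T] {x : T} {M N : ModuleCat.{u} T}
    (h : StablyAnnihilates T x M) (i : N ⟶ M) (r : M ⟶ N) (hri : i ≫ r = 𝟙 N) : StablyAnnihilates T x N := by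
  obtain ⟨P, hPfin, hP, ι, π, hιπ⟩ := h
  refine ⟨P, hPfin, hP, i ≫ ι, π ≫ r, ?_⟩
  rw [Category.assoc, ← Category.assoc ι, hιπ, Linear.smul_comp, Linear.comp_smul, Category.id_comp, hri]

/-- HC-R in linear-map form: `r ∘ i = id_L` with `T`-linear `i : L → M`, `r : M → L` and `x ∈ s̲ann(M)` give
`x ∈ s̲ann(L)` (via `exists_comp_eq_smul_id_of_retract` on a free factorisation). [folklore] -/
theorem StablyAnnihilates.of_retract_linearMap {T : Type u} [CommRing T] {x : T} {M L : Type u} [AddCommGroup M]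
    [Module T M] [AddCommGroup L] [Module T L] (h : StablyAnnihilates T x (ModuleCat.of T M)) (i : L →ₗ[T] M)
    (r : M →ₗ[T] L) (hri : r ∘ₗ i = LinearMap.id) : StablyAnnihilates T x (ModuleCat.of T L) := by
  obtain ⟨s, ι, π, hιπ⟩ := (stablyAnnihilates_iff_exists_linearMap x (ModuleCat.of T M)).mp h
  obtain ⟨ι', π', h'⟩ := exists_comp_eq_smul_id_of_retract ι π hιπ i r hri
  exact stablyAnnihilates_of_linearMap ι' π' h'

/-! ## HC-3: base change -/

/-- **HC-3 · base change of stable annihilation** (the transfer step of the S-2 assembly): if `x` stably annihilates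
the `T`-module `Y`, then `algebraMap T T' x` stably annihilates `T' ⊗_T Y` over `T'` — base-change a free
factorisation `Y → Tˢ → Y` to `T' ⊗_T Y → T' ⊗_T Tˢ ≅ T'ˢ → T' ⊗_T Y` (`exists_comp_eq_smul_id_baseChange`).
[folklore] -/
theorem StablyAnnihilates.baseChange {T T' : Type u} [CommRing T] [CommRing T'] [Algebra T T'] {x : T}
    {Y : ModuleCat.{u} T} (h : StablyAnnihilates T x Y) :
    StablyAnnihilates T' (algebraMap T T' x) (ModuleCat.of T' (T' ⊗[T] Y)) := by
  obtain ⟨s, ι₀, π₀, h₀⟩ := (stablyAnnihilates_iff_exists_linearMap x Y).mp h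
  obtain ⟨ι, π, hιπ⟩ := exists_comp_eq_smul_id_baseChange T' ι₀ π₀ h₀
  exact stablyAnnihilates_of_linearMap ι π hιπ

/-- HC-3 for the DUAL of the base change: `algebraMap T T' x` stably annihilates `Hom_{T'}(T' ⊗_T Y, T')`
(HC-3 + `StablyAnnihilates.dual`, valid over any commutative ring). [folklore] -/
theorem StablyAnnihilates.dual_baseChange {T T' : Type u} [CommRing T] [CommRing T'] [Algebra T T'] {x : T}
    {Y : ModuleCat.{u} T} (h : StablyAnnihilates T x Y) :
    StablyAnnihilates T' (algebraMap T T' x) (ModuleCat.of T' (Module.Dual T' (T' ⊗[T] Y))) :=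
  (StablyAnnihilates.baseChange h).dual

/-- HC-3 for the REFLEXIVE HULL `(T' ⊗_T Y)**` of the base change (HC-3 + `StablyAnnihilates.dual` twice).
[folklore] -/
theorem StablyAnnihilates.dual_dual_baseChange {T T' : Type u} [CommRing T] [CommRing T'] [Algebra T T'] {x : T}
    {Y : ModuleCat.{u} T} (h : StablyAnnihilates T x Y) :
    StablyAnnihilates T' (algebraMap T T' x) (ModuleCat.of T' (Module.Dual T' (Module.Dual T' (T' ⊗[T] Y)))) :=
  (StablyAnnihilates.dual_baseChange h).dual

/-! ## HC-0 / HC-1 / HC-2: persistence from covers of the syzygies -/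

/-- **HC-0 · the SOURCE side** (= CA1 forward, W4.4 p497920, recorded for the assembly): `x ∈ caᵐ⁺¹(T)` stably
annihilates every `m`-th syzygy of every finitely generated `T`-module. [cite: IyengarTakahashi2014, Remark 2.13] -/
theorem stablyAnnihilates_of_mem_cohomologyAnnihilatorOfDegree_succ
    {T : Type u} [CommRing T] [IsNoetherianRing T] {x : T} {m : ℕ}
    (hx : x ∈ cohomologyAnnihilatorOfDegree T (m + 1)) (M L : ModuleCat.{u} T)
    (hM : Module.Finite T M) (hL : IsSyzygy m M L) : StablyAnnihilates T x L :=
  (mem_cohomologyAnnihilatorOfDegree_succ_iff_forall_isSyzygy x).mp hx M L hM hL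

/-- **HC-1 · level-`(m+1)` persistence from a DUAL-BASE-CHANGE COVER of the `m`-th syzygies over `T'`**: if every
`m`-th syzygy `L` of a finitely generated `T'`-module is a retract of `Hom_{T'}(T' ⊗_T Y, T')` for some finitely
generated `T`-module `Y` that `x` stably annihilates, then `algebraMap T T' x ∈ caᵐ⁺¹(T')`. Proof: CA1 backward over
`T'`; for each syzygy HC-3, `StablyAnnihilates.dual`, HC-R — exponent one throughout, no flatness or reflexivity used.
(The conjunct `Module.Finite T Y` is part of the cover datum as planned; the implication does not use it.)
[cite: IyengarTakahashi2014, Remark 2.13] -/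
theorem map_mem_cohomologyAnnihilatorOfDegree_succ_of_dualBaseChangeCover
    {T T' : Type u} [CommRing T] [CommRing T'] [IsNoetherianRing T'] [Algebra T T'] (x : T) (m : ℕ)
    (hcover : ∀ (M L : ModuleCat.{u} T'), Module.Finite T' M → IsSyzygy m M L →
      ∃ (Y : ModuleCat.{u} T), Module.Finite T Y ∧ StablyAnnihilates T x Y ∧
        ∃ (i : L →ₗ[T'] Module.Dual T' (T' ⊗[T] Y))
          (r : Module.Dual T' (T' ⊗[T] Y) →ₗ[T'] L), r ∘ₗ i = LinearMap.id) :
    algebraMap T T' x ∈ cohomologyAnnihilatorOfDegree T' (m + 1) := by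
  refine (mem_cohomologyAnnihilatorOfDegree_succ_iff_forall_isSyzygy _).mpr fun M L hM hL => ?_
  obtain ⟨Y, -, hY, i, r, hri⟩ := hcover M L hM hL
  refine StablyAnnihilates.of_retract (StablyAnnihilates.dual_baseChange hY) (ModuleCat.ofHom i)
    (ModuleCat.ofHom r) ?_
  ext l
  have hl : r (i l) = l := LinearMap.congr_fun hri l
  simp [hl]

/-- **HC-2 · the same with the REFLEXIVE HULL `(T' ⊗_T Y)**` as the covering module** (the `HullDescentStep` shape
of p486264 in the CA-layer's vocabulary). [cite: IyengarTakahashi2014, Remark 2.13] -/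
theorem map_mem_cohomologyAnnihilatorOfDegree_succ_of_hullBaseChangeCover
    {T T' : Type u} [CommRing T] [CommRing T'] [IsNoetherianRing T'] [Algebra T T'] (x : T) (m : ℕ)
    (hcover : ∀ (M L : ModuleCat.{u} T'), Module.Finite T' M → IsSyzygy m M L →
      ∃ (Y : ModuleCat.{u} T), Module.Finite T Y ∧ StablyAnnihilates T x Y ∧
        ∃ (i : L →ₗ[T'] Module.Dual T' (Module.Dual T' (T' ⊗[T] Y)))
          (r : Module.Dual T' (Module.Dual T' (T' ⊗[T] Y)) →ₗ[T'] L), r ∘ₗ i = LinearMap.id) :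
    algebraMap T T' x ∈ cohomologyAnnihilatorOfDegree T' (m + 1) := by
  refine (mem_cohomologyAnnihilatorOfDegree_succ_iff_forall_isSyzygy _).mpr fun M L hM hL => ?_
  obtain ⟨Y, -, hY, i, r, hri⟩ := hcover M L hM hL
  refine StablyAnnihilates.of_retract (StablyAnnihilates.dual_dual_baseChange hY) (ModuleCat.ofHom i)
    (ModuleCat.ofHom r) ?_
  ext l
  have hl : r (i l) = l := LinearMap.congr_fun hri l
  simp [hl]

/-- **HC-1 with a PLAIN base-change cover** (no dual): if every `m`-th syzygy over `T'` is a retract of `T' ⊗_T Y`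
itself for some `x`-stably-annihilated `T`-module `Y`, then `algebraMap T T' x ∈ caᵐ⁺¹(T')`. [folklore] -/
theorem map_mem_cohomologyAnnihilatorOfDegree_succ_of_baseChangeCover
    {T T' : Type u} [CommRing T] [CommRing T'] [IsNoetherianRing T'] [Algebra T T'] (x : T) (m : ℕ)
    (hcover : ∀ (M L : ModuleCat.{u} T'), Module.Finite T' M → IsSyzygy m M L →
      ∃ (Y : ModuleCat.{u} T), StablyAnnihilates T x Y ∧
        ∃ (i : L →ₗ[T'] T' ⊗[T] Y) (r : T' ⊗[T] Y →ₗ[T'] L), r ∘ₗ i = LinearMap.id) :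
    algebraMap T T' x ∈ cohomologyAnnihilatorOfDegree T' (m + 1) := by
  refine (mem_cohomologyAnnihilatorOfDegree_succ_iff_forall_isSyzygy _).mpr fun M L hM hL => ?_
  obtain ⟨Y, hY, i, r, hri⟩ := hcover M L hM hL
  refine StablyAnnihilates.of_retract (StablyAnnihilates.baseChange hY) (ModuleCat.ofHom i)
    (ModuleCat.ofHom r) ?_
  ext l
  have hl : r (i l) = l := LinearMap.congr_fun hri l
  simp [hl]

end Summit.ResolutionOfSingularities.ResolutionOfSingularities.Theorems.HomologicalConductor.PersistenceSurfaceHullCover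

end
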